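import Mathlib
import Summits.ResolutionOfSingularities.ResolutionOfSingularities.Theorems.RadicialJungCleanModelsCleanPatchingDefs
import Summits.ResolutionOfSingularities.ResolutionOfSingularities.Theorems.RadicialJungCleanModelsCleanRegTransport
import Literature.AlgebraicGeometry.Resolution.BadCurveInduction
import HarnessLib

/-!
# Route `RadicialJung`, crux `CleanModels` (stmt-ResolutionOfSingularities-15917), line `Sketch` rev 14, stub 4b
# `stub_cleanTwoModelPatching3`: Piltant's Axiom 4 for `P_clean` on an open of clean-regular points of a model

Kernel transfer of the tree's PROVED `P_reg` patching chain (`PatchingMorphismStep.lean` … `BadCurveInduction.lean`) to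
the regularity property `P_clean(g₀)` (`ModelCleanRegAt`, `RadicialJungCleanModelsCleanPatchingDefs.lean`), part 1: the
input of every step of the chain — «principalize a non-zero ideal sheaf on an open `U` of the model `M` by a
Cossart–Piltant sequence `σ : S' → U`, extend it to a projective modification `ρ : X' → M`
(`IsRegularCentreBlowupSeq.exists_extension_full`), and know the points of `X'` over `U` are GOOD».  For `P_reg`,
«good» = regular came from regularity of `S'`; for `P_clean` it comes from the last clause of the hypothesis `hT4`
of the stub (Cossart–Piltant Prop. 4.4 KEEPING cleanness = the research stub 4e, applied to the open subscheme `U`,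
an everywhere-clean regular excellent Noetherian integral threefold when `trdeg_k K = 3`), transported from `S'` to
`X'` along the open immersion `j' : S' → X'` (`CleanRegAt.of_functionFieldMap_of_isIso_stalkMap`).

* `ModelCleanRegAt.of_isIso_stalkMap` — clean-regularity lifts along local isomorphisms of models;
* `modelCleanRegAt_ofModification_iff` — clean-regularity on a modification model `ofModification M ρ …` read on the
  scheme `X'` through `ρ^♯ (g₀)`;
* `cleanRegAt_opens` — the points of the open subscheme `U` are clean-regular for `g₀` read in `K(U)`;
* `exists_cleanExtension` — THE INPUT SHAPE: `S', X', σ, ρ, j'` with all the conclusions of `exists_extension_full`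
  and clean-regularity of `X'` at the points `j'(s')`.

All PROVED (the research content is the hypothesis `hT4`); nothing here proves resolution in characteristic `p`.
-/

noncomputable section

set_option linter.dupNamespace false -- mandated namespace of this single-conjunct summit

open CategoryTheory CategoryTheory.Limits AlgebraicGeometry TopologicalSpace IsLocalRing
open Literature.AlgebraicGeometry.Resolution Literature.AlgebraicGeometry.Motives

namespace Summit.ResolutionOfSingularities.ResolutionOfSingularities.Theorems.RadicialJung.CleanModels

variable {p : ℕ} {k K : Type} [Field k] [Field K] [Algebra k K]

/-! ## Clean-regularity along local isomorphisms and on modification models -/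

/-- **Clean-regularity lifts along local isomorphisms of models**: if `φ : N → M` induces an isomorphism of stalks
at `y`, then `𝒪_{N,y} = 𝒪_{M,φ y}` inside `K` (`ProjModel.stalkSubring_eq_of_isIso_stalkMap`). [folklore] -/
theorem ModelCleanRegAt.of_isIso_stalkMap {g₀ : K} {N M : ProjModel k K} (φ : N.Hom M) (y : N.X)
    [IsIso (φ.f.stalkMap y)] (h : ModelCleanRegAt p g₀ M (φ.f y)) : ModelCleanRegAt p g₀ N y :=
  modelCleanRegAt_of_stalkSubring_eq (ProjModel.stalkSubring_eq_of_isIso_stalkMap φ y) h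

/-- **Clean-regularity lifts along a morphism of models which is an isomorphism over an open containing the image
point.** [folklore] -/
theorem ModelCleanRegAt.of_isIso_morphismRestrict {g₀ : K} {N M : ProjModel k K} (φ : N.Hom M) (W : M.X.Opens)
    [IsIso (φ.f ∣_ W)] (y : N.X) (hy : φ.f y ∈ W) (h : ModelCleanRegAt p g₀ M (φ.f y)) :
    ModelCleanRegAt p g₀ N y := by
  haveI := isIso_stalkMap_of_isIso_morphismRestrict φ.f W y hy
  exact h.of_isIso_stalkMap φ y

/-- **Clean-regularity on a modification model, read on the scheme**: for `N = ofModification M ρ V …` (underlying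
scheme `X'`, `N → M` the morphism `ρ`), `x' ∈ X'` is clean-regular for `g₀` iff the stalk `𝒪_{X',x'}` read in `K(X')`
is clean-regular for `ρ^♯ ((K ≅ K(M))⁻¹ g₀)`. [folklore] -/
theorem modelCleanRegAt_ofModification_iff {g₀ : K} (M : ProjModel k K) {X' : Scheme.{0}} [IsIntegral X']
    (ρ : X' ⟶ M.X) [IsDominant ρ] (V : M.X.Opens) (hV : (V : Set M.X).Nonempty) [IsIso (ρ ∣_ V)]
    (hproj : Literature.AlgebraicGeometry.Motives.IsProjectiveOver
      (Over.mk (ρ ≫ M.π) : Literature.AlgebraicGeometry.Motives.SchemeOver k)) (x' : X') :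
    ModelCleanRegAt p g₀ (ProjModel.ofModification M ρ V hV hproj) x' ↔
      CleanRegAt p (algebraMap (X'.presheaf.stalk x') X'.functionField)
        (RatFn.functionFieldMap ρ (M.funFieldIso.inv.hom g₀)) := by
  rw [modelCleanRegAt_iff_stalk]
  have h : RatFn.functionFieldMap ρ (M.funFieldIso.inv.hom g₀) =
      (ProjModel.ofModification M ρ V hV hproj).funFieldIso.inv.hom g₀ :=
    ProjModel.functionFieldMap_funFieldIso_inv (ProjModel.ofModificationHom M ρ V hV hproj) g₀
  rw [h]
  rfl

/-! ## The open subscheme of clean-regular points -/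

/-- A non-empty open of an integral scheme is dense, so its inclusion is dominant. [folklore] -/
theorem isDominant_ι_of_nonempty {X : Scheme.{0}} [IsIntegral X] (U : X.Opens) (hUne : (U : Set X).Nonempty) :
    IsDominant U.ι :=
  Opens.isDominant_ι (U.isOpen.dense hUne)

/-- **The points of the open subscheme `U ⊆ M` are clean-regular** (for `g₀` read in `K(U)` through `U ↪ M`), if the
points of `U` are clean-regular points of the model `M`. [folklore] -/
theorem cleanRegAt_opens {g₀ : K} (M : ProjModel k K) (U : M.X.Opens) (hU : ∀ x ∈ U, ModelCleanRegAt p g₀ M x)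
    [IsIntegral (U : Scheme.{0})] [IsDominant U.ι] (s : (U : Scheme.{0})) :
    CleanRegAt p (algebraMap ((U : Scheme.{0}).presheaf.stalk s) (U : Scheme.{0}).functionField)
      (RatFn.functionFieldMap U.ι (M.funFieldIso.inv.hom g₀)) := by
  have h : ModelCleanRegAt p g₀ M (U.ι s) := hU _ (by rw [Scheme.Opens.ι_apply]; exact s.2)
  rw [modelCleanRegAt_iff_stalk] at h
  exact CleanRegAt.functionFieldMap_of_isIso_stalkMap U.ι s h

/-- The open subscheme of clean-regular points is regular. [folklore] -/
theorem isRegular_opens_of_modelCleanRegAt {g₀ : K} (M : ProjModel k K) (U : M.X.Opens)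
    (hU : ∀ x ∈ U, ModelCleanRegAt p g₀ M x) : Scheme.IsRegular (U : Scheme.{0}) := fun x => by
  have hx : ModelCleanRegAt p g₀ M (U.ι x) := hU _ (by rw [Scheme.Opens.ι_apply]; exact x.2)
  haveI : IsRegularLocalRing (M.X.presheaf.stalk (U.ι x)) := hx.isRegularLocalRing_stalk
  exact IsRegularLocalRing.of_ringEquiv (asIso (U.ι.stalkMap x)).commRingCatIsoToRingEquiv

/-- Clean-regular points are regular points. [folklore] -/
theorem subset_regularLocus_of_modelCleanRegAt {g₀ : K} (M : ProjModel k K) (U : M.X.Opens)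
    (hU : ∀ x ∈ U, ModelCleanRegAt p g₀ M x) : (U : Set M.X) ⊆ Scheme.regularLocus M.X :=
  fun x hx => (hU x hx).isRegularLocalRing_stalk

/-! ## The input shape of the patching steps: principalize on `U`, extend, keep cleanness -/

/-- **Piltant's Axiom 4 for `P_clean` on an open of clean-regular points, with the extension to the model.**  Let
`k` have characteristic `p`, `trdeg_k K = 3`, `M` a projective model of `K/k`, `U ⊆ M` a non-empty open all of whose
points are clean-regular for the `K^p`-line of `g₀`, and `J ≠ 0` an ideal sheaf on the open subscheme `U`.  Assuming
`hT4` (Cossart–Piltant's Prop. 4.4 keeping cleanness, the stub `stub_cleanPrincipalization3`): there are a sequence of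
blowing ups `σ : S' → U` along regular centres in the non-locally-principal loci principalizing `J`, and a projective
birational `ρ : X' → M` with an open immersion `j' : S' → X'` making a pullback square over `U ↪ M`, such that every
point of `X'` over `U` is some `j'(s')`, `ρ` is an isomorphism off the closure of the image of the non-principal locus
of `J`, and `X'` is CLEAN-REGULAR at every `j'(s')` for `ρ^♯ g₀`.
[cite: Piltant2013, §2 Axiom 4; CossartPiltant2019, Prop. 4.4] -/
theorem exists_cleanExtension
    (hT4 : ∀ (p : ℕ), p.Prime → ∀ (S : Scheme.{0}) [IsIntegral S] [IsNoetherian S],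
      CharP S.functionField p → Scheme.IsRegular S → Scheme.IsExcellent S → topologicalKrullDim S = 3 →
      ∀ G : S.functionField, (∀ s : S, CleanRegAt p (algebraMap (S.presheaf.stalk s) S.functionField) G) →
      ∀ J : S.IdealSheafData, J ≠ ⊥ →
      ∃ (S' : Scheme.{0}) (σ : S' ⟶ S) (_ : IsIntegral S') (_ : IsDominant σ),
      IsRegularCentreBlowupSeq σ J ∧ IsLocallyPrincipal (J.comap σ) ∧
      ∀ s' : S', CleanRegAt p (algebraMap (S'.presheaf.stalk s') S'.functionField) (RatFn.functionFieldMap σ G))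
    (hp : p.Prime) [CharP k p] (htr : Algebra.trdeg k K = 3) (g₀ : K) (M : ProjModel k K) (U : M.X.Opens)
    (hU : ∀ x ∈ U, ModelCleanRegAt p g₀ M x) (hUne : (U : Set M.X).Nonempty)
    (J : (U : Scheme.{0}).IdealSheafData) (hJ : J ≠ ⊥) :
    ∃ (S' X' : Scheme.{0}) (σ : S' ⟶ U) (ρ : X' ⟶ M.X) (j' : S' ⟶ X') (_ : IsIntegral S') (_ : IsIntegral X')
      (_ : IsDominant ρ) (_ : IsOpenImmersion j'),
      IsRegularCentreBlowupSeq σ J ∧ IsLocallyPrincipal (J.comap σ) ∧ IsPullback j' σ ρ U.ι ∧ IsProper ρ ∧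
      IsBirational ρ ∧ Literature.AlgebraicGeometry.Motives.IsProjectiveOver
      (Over.mk (ρ ≫ M.π) : Literature.AlgebraicGeometry.Motives.SchemeOver k) ∧
      (∀ x' : X', ρ x' ∈ Set.range U.ι → ∃ s' : S', j' s' = x') ∧ IsIso (ρ ∣_ principalOpen U.ι J) ∧
      ∀ s' : S', CleanRegAt p (algebraMap (X'.presheaf.stalk (j' s')) X'.functionField)
        (RatFn.functionFieldMap ρ (M.funFieldIso.inv.hom g₀)) := by
  classical
  /- (1) the open subscheme `U`: integral, Noetherian, regular, excellent, of dimension `3`, characteristic `p` -/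
  haveI : Nonempty (U : Scheme.{0}) := hUne.to_subtype
  haveI hintU : IsIntegral (U : Scheme.{0}) := isIntegral_of_isOpenImmersion U.ι
  haveI : CompactSpace (U : Scheme.{0}) :=
    isCompact_iff_compactSpace.mp (NoetherianSpace.isCompact (U : Set M.X))
  haveI : IsNoetherian (U : Scheme.{0}) := ⟨⟩
  haveI : IsDominant U.ι := isDominant_ι_of_nonempty U hUne
  have hregU : Scheme.IsRegular (U : Scheme.{0}) := isRegular_opens_of_modelCleanRegAt M U hU
  have hexcU : Scheme.IsExcellent (U : Scheme.{0}) :=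
    Scheme.isExcellent_of_locallyOfFiniteType Stacks07QW_field_holds (U.ι ≫ M.π)
  have hdimU : topologicalKrullDim (U : Scheme.{0}) = 3 :=
    (topologicalKrullDim_opens_eq M.π U hUne).trans (by rw [M.topologicalKrullDim_eq_of_trdeg htr]; rfl)
  haveI : CharP K p := charP_of_injective_algebraMap (algebraMap k K).injective p
  have hcharU : CharP (U : Scheme.{0}).functionField p :=
    charP_of_injective_ringHom
      (((RatFn.functionFieldMap U.ι).comp M.funFieldIso.inv.hom).injective) p
  /- (2) Axiom 4 for `P_clean` on `U` -/
  let GU : (U : Scheme.{0}).functionField := RatFn.functionFieldMap U.ι (M.funFieldIso.inv.hom g₀)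
  have hGU : ∀ s : (U : Scheme.{0}),
      CleanRegAt p (algebraMap ((U : Scheme.{0}).presheaf.stalk s) (U : Scheme.{0}).functionField) GU :=
    cleanRegAt_opens M U hU
  obtain ⟨S', σ, hintS', hdomσ, hσ, hprinc, hcleanS'⟩ := hT4 p hp (U : Scheme.{0}) hcharU hregU hexcU hdimU GU hGU J hJ
  /- (3) extension to `M` -/
  obtain ⟨X', ρ, j', hj', hpb, hprop, hint', hbir, hproj, -, hover, hisoP⟩ :=
    hσ.exists_extension_full hregU hJ U.ι
  haveI := hj'
  haveI := hint'
  have hproj' : Literature.AlgebraicGeometry.Motives.IsProjectiveOver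
      (Over.mk (ρ ≫ M.π) : Literature.AlgebraicGeometry.Motives.SchemeOver k) :=
    hproj k M.π M.isProjectiveOver
  -- `ρ` is dominant: it is the morphism of the modification model
  obtain ⟨U₀, hU₀, hiso⟩ := M.exists_nonempty_isIso_morphismRestrict hbir
  haveI := hiso
  haveI hdomρ : IsDominant ρ := (ProjModel.ofModificationHom M ρ U₀ hU₀ hproj').isDominant
  haveI := hintS'
  haveI hdomj' : IsDominant j' := ⟨j'.isOpenEmbedding.isOpen_range.dense (Set.range_nonempty _)⟩
  /- (4) cleanness on `X'` at the points `j'(s')` -/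
  refine ⟨S', X', σ, ρ, j', hintS', hint', hdomρ, hj', hσ, hprinc, hpb, hprop, hbir, hproj', hover, hisoP,
    fun s' => ?_⟩
  have hbij : Function.Bijective (RatFn.functionFieldMap j') := RatFn.functionFieldMap_bijective_of_isOpenImmersion j'
  refine CleanRegAt.of_functionFieldMap_of_isIso_stalkMap j' s' hbij ?_
  have hcomp : RatFn.functionFieldMap j' (RatFn.functionFieldMap ρ (M.funFieldIso.inv.hom g₀)) =
      RatFn.functionFieldMap σ GU := by
    change ((RatFn.functionFieldMap j').comp (RatFn.functionFieldMap ρ)) (M.funFieldIso.inv.hom g₀) =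
      ((RatFn.functionFieldMap σ).comp (RatFn.functionFieldMap U.ι)) (M.funFieldIso.inv.hom g₀)
    rw [← RatFn.functionFieldMap_comp, ← RatFn.functionFieldMap_comp, RatFn.functionFieldMap_congr hpb.w]
  rw [hcomp]
  exact hcleanS' s'

end Summit.ResolutionOfSingularities.ResolutionOfSingularities.Theorems.RadicialJung.CleanModels

end
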